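import Mathlib

/-!
# LINE «kernel_budget» (stmt-NavierStokesRegularity-21883) — FIRST TARGETS (rev 1.1, «mean-value sign law»)

Two elementary potential-theoretic identities that make the sign-law bookkeeping of the line EXACT (card addendum
`Lines/kernel_budget_meanvalue.md`): the mean distance from an interior point to a spherical shell, and the resulting
Newton-type theorem for the ξξ-component of the Oseen tensor `(1/|z|)(1 + z_ξ²/|z|²)/(8π)`: its shell average is the same for
every interior source point (`= (4/3)·⨍ 1/|x|`).  Both are M-sized Mathlib exercises (polar coordinates); stated here as sorried
targets for an idle prover (`--supports stmt-NavierStokesRegularity-21883`).  Nothing here proves anything about Navier–Stokes. [folklore]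
-/

noncomputable section
open MeasureTheory Set
open scoped InnerProductSpace RealInnerProductSpace

namespace Summit.NavierStokesRegularity.NavierStokesRegularity.Cruxes.NearExtremalTransience.KernelBudget.Targets

set_option linter.style.longLine false
set_option linter.dupNamespace false
set_option linter.unusedVariables false

/-- The spherical shell `{r₁ < |x| < r₂}` in `ℝ³`. -/
def shell (r₁ r₂ : ℝ) : Set (EuclideanSpace ℝ (Fin 3)) := {x | r₁ < ‖x‖ ∧ ‖x‖ < r₂}

/-- **T1 · mean distance to a shell (interior point).**  For `|y| ≤ r₁ < r₂`:
`⨍_{r₁<|x|<r₂} |x − y| dx = (3·(r₂⁴ − r₁⁴)/4 + |y|²·(r₂² − r₁²)/2) / (r₂³ − r₁³)`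
(integrate the sphere formula `⨍_{|x|=s}|x − y| = s + |y|²/(3s)` against `s² ds`). [folklore] -/
theorem target_shellAverage_dist {r₁ r₂ : ℝ} (hr₁ : 0 < r₁) (hr : r₁ < r₂) {y : EuclideanSpace ℝ (Fin 3)} (hy : ‖y‖ ≤ r₁) :
    ⨍ x in shell r₁ r₂, ‖x - y‖ = (3 * (r₂ ^ 4 - r₁ ^ 4) / 4 + ‖y‖ ^ 2 * (r₂ ^ 2 - r₁ ^ 2) / 2) / (r₂ ^ 3 - r₁ ^ 3) := by
  sorry

/-- **T2 · Newton-type theorem for the Oseen ξξ-kernel.**  For a unit vector `e`, every interior source point `|y| ≤ r₁` gives the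
same shell average of `z ↦ (1 + ⟪z,e⟫²/|z|²)/|z|`, namely `4/3` of the shell average of `1/|x|`:
`⨍_{r₁<|x|<r₂} (1/|x−y| + ⟪x−y,e⟫²/|x−y|³) dx = (4/3)·⨍_{r₁<|x|<r₂} 1/|x| dx = 2·(r₂² − r₁²)/(r₂³ − r₁³)`
(apply `δ_ijΔ − ∂_i∂_j` in `y` to T1's sphere version: `Δ_y(s + |y|²/3s) = 2/s`, `∂_e∂_e(…) = 2/(3s)`). [folklore] -/
theorem target_shellAverage_oseen {r₁ r₂ : ℝ} (hr₁ : 0 < r₁) (hr : r₁ < r₂) {y e : EuclideanSpace ℝ (Fin 3)} (hy : ‖y‖ ≤ r₁)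
    (he : ‖e‖ = 1) :
    ⨍ x in shell r₁ r₂, (1 / ‖x - y‖ + ⟪x - y, e⟫ ^ 2 / ‖x - y‖ ^ 3) = 2 * (r₂ ^ 2 - r₁ ^ 2) / (r₂ ^ 3 - r₁ ^ 3) := by
  sorry

/-- **T3 · exterior source point.**  For `|y| ≥ r₂` the sphere means are `⨍_{|x|=s}|x − y| = |y| + s²/(3|y|)`, whence the explicit
exterior profile used in the tail law: `⨍_{|x|=s}(1/|x−y| + ⟪x−y,e⟫²/|x−y|³) = (1 + cos²θ)/|y| − s²(3cos²θ − 1)/(3|y|³)`,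
`cos θ = ⟪y,e⟫/|y|`; shell version below. [folklore] -/
theorem target_shellAverage_oseen_ext {r₁ r₂ : ℝ} (hr₁ : 0 < r₁) (hr : r₁ < r₂) {y e : EuclideanSpace ℝ (Fin 3)} (hy : r₂ ≤ ‖y‖)
    (he : ‖e‖ = 1) :
    ⨍ x in shell r₁ r₂, (1 / ‖x - y‖ + ⟪x - y, e⟫ ^ 2 / ‖x - y‖ ^ 3) =
      (1 + (⟪y, e⟫ / ‖y‖) ^ 2) / ‖y‖ - (3 * (r₂ ^ 5 - r₁ ^ 5) / (5 * (r₂ ^ 3 - r₁ ^ 3))) * (3 * (⟪y, e⟫ / ‖y‖) ^ 2 - 1) / (3 * ‖y‖ ^ 3) := by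
  sorry

end Summit.NavierStokesRegularity.NavierStokesRegularity.Cruxes.NearExtremalTransience.KernelBudget.Targets
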